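import Mathlib

/-!
# Graph and sumset lemmas for the exact form of `(C_θ)` above density `1/2`

Preparatory lemmas for `SoloInformedHalfDensityExactThreshold` (which see for the context, the
references and the main theorem `soloFS_exact_CTheta_of_gt_half`):

* `soloFS_sum_eq_of_exact` — "no violated additive coincidence" in symmetric (Freiman
  `2`-homomorphism) form `a + b = c + d ⇒ φ a + φ b = φ c + φ d`;
* `soloFS_card_add_self_le` — `#(S + S) + 1 ≤ 2K` for `S ⊆ [1, K]`;
* `soloFS_card_image_add_image_le` — `#(f(S) + f(S)) ≤ #(S + S)` when `f a + f b` depends only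
  on `a + b` (`a, b ∈ S`);
* `soloFS_affine_of_param` — a rational parametrisation `(a, φ a) = c + t • u` (`t ∈ ℚ`) of the
  graph of `φ` on `T` makes `φ` affine on `T`;
* `soloFS_rank_three_bound` — Freiman's lemma (as the explicit hypothesis `hFreiman`,
  [cite: TaoVu2006, Lemma 5.13]; G. A. Freiman 1973) transported by coordinates to a finite set
  `Y ∋ 0` of `ℚ`-rank `≥ 3` in an arbitrary `ℚ`-vector space: `4 #Y ≤ #(Y + Y) + 6`;
* `soloFS_clear_den`, `soloFS_plane_coords` — if the `ℚ`-span of `v(S)` has dimension `2`, the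
  points `v a` (`a ∈ S`) have integer coordinates `z a ∈ ℤ²` with respect to a suitable pair of
  vectors, and additive coincidences among the `v a` transfer to the `z a`.

Mathlib only; no definitions are introduced; no novelty is claimed.  Role: support file of the
toy layer of this seat (node `RoyAdditiveDirichletExponent`).
-/

namespace Summit.Schanuel.Schanuel.Theorems

open Finset
open scoped Pointwise

/-! ### Exactness in symmetric form; the sumset of a subset of `[1, K]` -/

/-- The "no violated additive coincidence" hypothesis in symmetric (Freiman `2`-homomorphism)
form: `a + b = c + d` on `S` implies `φ a + φ b = φ c + φ d`. -/
theorem soloFS_sum_eq_of_exact {G : Type*} [AddCommGroup G] {S : Finset ℕ} {φ : ℕ → G}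
    (hex : ∀ a ∈ S, ∀ b ∈ S, ∀ u : ℕ, a + u ∈ S → b + u ∈ S →
      φ (a + u) - φ a = φ (b + u) - φ b)
    {a b c d : ℕ} (ha : a ∈ S) (hb : b ∈ S) (hc : c ∈ S) (hd : d ∈ S) (h : a + b = c + d) :
    φ a + φ b = φ c + φ d := by
  by_cases hac : a ≤ c
  · obtain ⟨u, rfl⟩ := Nat.exists_eq_add_of_le hac
    have hb' : b = d + u := by omega
    subst hb'
    have key := hex a ha d hd u hc hb
    rw [sub_eq_sub_iff_add_eq_add] at key
    -- key : φ (a + u) + φ d = φ (d + u) + φ a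
    rw [add_comm (φ a), ← key, add_comm]
  · obtain ⟨u, rfl⟩ := Nat.exists_eq_add_of_le (Nat.le_of_not_le hac)
    have hd' : d = b + u := by omega
    subst hd'
    have key := hex c hc b hb u ha hd
    rw [sub_eq_sub_iff_add_eq_add] at key
    -- key : φ (c + u) + φ b = φ (b + u) + φ c
    rw [key, add_comm]

/-- For `S ⊆ [1, K]` the sumset `S + S` lies in `[2, 2K]`, so `#(S + S) + 1 ≤ 2 K`
(for `K ≥ 1`; for `K = 0` the set is empty). -/
theorem soloFS_card_add_self_le {S : Finset ℕ} {K : ℕ} (hS : S ⊆ Finset.Icc 1 K) (hK : 1 ≤ K) :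
    (S + S).card + 1 ≤ 2 * K := by
  have hsub : S + S ⊆ Finset.Icc 2 (2 * K) := by
    intro x hx
    obtain ⟨a, ha, b, hb, rfl⟩ := Finset.mem_add.mp hx
    have ha' := Finset.mem_Icc.mp (hS ha)
    have hb' := Finset.mem_Icc.mp (hS hb)
    exact Finset.mem_Icc.mpr ⟨by omega, by omega⟩
  have := Finset.card_le_card hsub
  rw [Nat.card_Icc] at this
  omega

/-- **Sumsets under a map compatible with coincidences.**  If `f a + f b` depends only on
`a + b` for `a, b ∈ S`, then `#(f(S) + f(S)) ≤ #(S + S)`. -/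
theorem soloFS_card_image_add_image_le {ι X : Type*} [Add ι] [Add X] [DecidableEq ι]
    [DecidableEq X] (S : Finset ι) (f : ι → X)
    (hf : ∀ a ∈ S, ∀ b ∈ S, ∀ c ∈ S, ∀ d ∈ S, a + b = c + d → f a + f b = f c + f d) :
    (S.image f + S.image f).card ≤ (S + S).card := by
  classical
  rcases S.eq_empty_or_nonempty with hS | ⟨i₀, hi₀⟩
  · subst hS; simp
  let h : ι → X := fun n =>
    if hn : ∃ p : ι × ι, p.1 ∈ S ∧ p.2 ∈ S ∧ p.1 + p.2 = n then
      f (Classical.choose hn).1 + f (Classical.choose hn).2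
    else f i₀ + f i₀
  have key : S.image f + S.image f ⊆ (S + S).image h := by
    intro x hx
    obtain ⟨y, hy, z, hz, rfl⟩ := Finset.mem_add.mp hx
    obtain ⟨a, ha, rfl⟩ := Finset.mem_image.mp hy
    obtain ⟨b, hb, rfl⟩ := Finset.mem_image.mp hz
    refine Finset.mem_image.mpr ⟨a + b, Finset.add_mem_add ha hb, ?_⟩
    have hn : ∃ p : ι × ι, p.1 ∈ S ∧ p.2 ∈ S ∧ p.1 + p.2 = a + b := ⟨(a, b), ha, hb, rfl⟩
    show (if hn : ∃ p : ι × ι, p.1 ∈ S ∧ p.2 ∈ S ∧ p.1 + p.2 = a + b then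
      f (Classical.choose hn).1 + f (Classical.choose hn).2 else f i₀ + f i₀) = f a + f b
    rw [dif_pos hn]
    obtain ⟨hc, hd, hcd⟩ := Classical.choose_spec hn
    exact hf _ hc _ hd _ ha _ hb hcd
  exact (Finset.card_le_card key).trans Finset.card_image_le

/-! ### Affine pieces from a rational parametrisation of the graph -/

/-- If the graph points `((a : ℚ), φ a)`, `a ∈ T`, all have the form `c + t • u` with `t ∈ ℚ`,
then `φ` is affine on `T`: `φ a = γ + a μ`. -/
theorem soloFS_affine_of_param {T : Finset ℕ} {φ : ℕ → ℂ} (c u : ℚ × ℂ)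
    (h : ∀ a ∈ T, ∃ t : ℚ, (((a : ℕ) : ℚ), φ a) = c + t • u) :
    ∃ γ μ : ℂ, ∀ a ∈ T, φ a = γ + (a : ℂ) * μ := by
  by_cases hu : u.1 = 0
  · rcases T.eq_empty_or_nonempty with hT | ⟨a₁, ha₁⟩
    · exact ⟨0, 0, by simp [hT]⟩
    · refine ⟨φ a₁, 0, fun a ha => ?_⟩
      obtain ⟨t, ht⟩ := h a ha
      obtain ⟨t₁, ht₁⟩ := h a₁ ha₁
      have h1 := congrArg Prod.fst ht
      have h2 := congrArg Prod.fst ht₁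
      simp only [Prod.fst_add, Prod.smul_fst, smul_eq_mul, hu, mul_zero, add_zero] at h1 h2
      have : a = a₁ := by exact_mod_cast h1.trans h2.symm
      subst this
      simp
  · refine ⟨c.2 - (((c.1 / u.1 : ℚ)) : ℂ) * u.2, (((1 / u.1 : ℚ)) : ℂ) * u.2, fun a ha => ?_⟩
    obtain ⟨t, ht⟩ := h a ha
    have h1 := congrArg Prod.fst ht
    have h2 := congrArg Prod.snd ht
    simp only [Prod.fst_add, Prod.smul_fst, smul_eq_mul, Prod.snd_add, Prod.smul_snd] at h1 h2
    have ht' : t = ((a : ℚ) - c.1) / u.1 := by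
      rw [eq_div_iff hu]; linarith
    rw [h2, Rat.smul_def, ht']
    have hu' : ((u.1 : ℚ) : ℂ) ≠ 0 := by exact_mod_cast hu
    push_cast
    field_simp
    ring

/-! ### Freiman's lemma, transferred to a rational vector space (case `d = 3`) -/

/-- **Rank transfer.**  Assuming Freiman's lemma for finite subsets of `ℝⁿ` (hypothesis
`hFreiman`), a finite set `Y ∋ 0` in a `ℚ`-vector space whose `ℚ`-span has dimension `≥ 3`
satisfies `4 #Y ≤ #(Y + Y) + 6`. -/
theorem soloFS_rank_three_bound
    (hFreiman : ∀ (n d : ℕ) (A : Finset (Fin n → ℝ)), 1 ≤ d →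
      d ≤ Module.finrank ℝ (vectorSpan ℝ (A : Set (Fin n → ℝ))) →
      (d + 1) * A.card ≤ (A + A).card + d * (d + 1) / 2)
    {W : Type*} [AddCommGroup W] [Module ℚ W] [DecidableEq W]
    (Y : Finset W) (h0 : (0 : W) ∈ Y)
    (h3 : 3 ≤ Module.finrank ℚ (Submodule.span ℚ (Y : Set W))) :
    4 * Y.card ≤ (Y + Y).card + 6 := by
  classical
  -- the span `U` of `Y`, a basis, and real coordinates
  haveI hfin : FiniteDimensional ℚ (Submodule.span ℚ (Y : Set W)) :=
    FiniteDimensional.span_of_finite ℚ Y.finite_toSet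
  obtain ⟨r, hr⟩ : ∃ r : ℕ, Module.finrank ℚ (Submodule.span ℚ (Y : Set W)) = r := ⟨_, rfl⟩
  let U : Submodule ℚ W := Submodule.span ℚ (Y : Set W)
  let b : Module.Basis (Fin r) ℚ U := Module.finBasisOfFinrankEq ℚ U hr
  have hmem : ∀ y ∈ Y, (y : W) ∈ U := fun y hy => Submodule.subset_span hy
  -- the coordinate map into `ℝʳ`
  let ρ : (Fin r → ℚ) →ₗ[ℚ] (Fin r → ℝ) :=
    { toFun := fun q i => ((q i : ℚ) : ℝ)
      map_add' := by intro q q'; funext i; push_cast [Pi.add_apply]; rfl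
      map_smul' := by intro c q; funext i; simp [Rat.smul_def] }
  let e : W → (Fin r → ℝ) := fun w =>
    if hw : w ∈ U then ρ (b.equivFun ⟨w, hw⟩) else 0
  have he : ∀ w (hw : w ∈ U), e w = ρ (b.equivFun ⟨w, hw⟩) := fun w hw => by
    simp only [e, dif_pos hw]
  have hρ_inj : Function.Injective ρ := by
    intro q q' h
    funext i
    have := congrFun h i
    change ((q i : ℚ) : ℝ) = ((q' i : ℚ) : ℝ) at this
    exact_mod_cast this
  have he_add : ∀ w, w ∈ U → ∀ w', w' ∈ U → e w + e w' = e (w + w') := by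
    intro w hw w' hw'
    rw [he w hw, he w' hw', he (w + w') (U.add_mem hw hw'), ← map_add, ← map_add]
    rfl
  have he_inj : ∀ w, w ∈ U → ∀ w', w' ∈ U → e w = e w' → w = w' := by
    intro w hw w' hw' hww
    rw [he w hw, he w' hw'] at hww
    have h1 := b.equivFun.injective (hρ_inj hww)
    exact congrArg Subtype.val h1
  -- the real model `A`
  set A : Finset (Fin r → ℝ) := Y.image e with hA
  have hAcard : A.card = Y.card :=
    Finset.card_image_of_injOn (fun y hy y' hy' h => he_inj y (hmem y hy) y' (hmem y' hy') h)
  have hAA : (A + A).card ≤ (Y + Y).card :=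
    soloFS_card_image_add_image_le Y e (by
      intro a ha b' hb c hc d hd habcd
      rw [he_add a (hmem a ha) b' (hmem b' hb), he_add c (hmem c hc) d (hmem d hd), habcd])
  -- Step 1: the elements of `Y` span `U`
  have hUtop : Submodule.span ℚ (Set.range (fun y : Y => (⟨(y : W), hmem y y.2⟩ : U))) = ⊤ := by
    apply top_unique
    rw [← Submodule.span_span_coe_preimage]
    apply Submodule.span_mono
    intro u hu
    exact ⟨⟨(u : W), hu⟩, Subtype.ext rfl⟩
  -- Step 2: their coordinate vectors span `ℚʳ`
  have hQtop :
      Submodule.span ℚ (Set.range (fun y : Y => b.equivFun ⟨(y : W), hmem y y.2⟩)) = ⊤ := by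
    have : Set.range (fun y : Y => b.equivFun ⟨(y : W), hmem y y.2⟩)
        = (b.equivFun : U →ₗ[ℚ] (Fin r → ℚ)) ''
            Set.range (fun y : Y => (⟨(y : W), hmem y y.2⟩ : U)) := by
      rw [← Set.range_comp]; rfl
    rw [this, Submodule.span_image, hUtop, Submodule.map_top, LinearMap.range_eq_top]
    intro x
    exact ⟨b.equivFun.symm x, b.equivFun.apply_symm_apply x⟩
  -- Step 3: the standard basis vectors of `ℝʳ` lie in the real span of `A`
  have hsub : ρ '' Set.range (fun y : Y => b.equivFun ⟨(y : W), hmem y y.2⟩)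
      ⊆ (A : Set (Fin r → ℝ)) := by
    rintro _ ⟨_, ⟨y, rfl⟩, rfl⟩
    rw [Finset.mem_coe, hA, Finset.mem_image]
    exact ⟨y, y.2, by rw [he _ (hmem y y.2)]⟩
  have hsingle : ∀ i : Fin r, (Pi.single i (1 : ℝ) : Fin r → ℝ)
      ∈ Submodule.span ℝ (A : Set (Fin r → ℝ)) := by
    intro i
    have h1 : (Pi.single i (1 : ℚ) : Fin r → ℚ)
        ∈ Submodule.span ℚ (Set.range (fun y : Y => b.equivFun ⟨(y : W), hmem y y.2⟩)) := by
      rw [hQtop]; exact Submodule.mem_top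
    have h2 : ρ (Pi.single i 1)
        ∈ Submodule.span ℚ (ρ '' Set.range (fun y : Y => b.equivFun ⟨(y : W), hmem y y.2⟩)) := by
      rw [Submodule.span_image]; exact Submodule.mem_map_of_mem h1
    have h3 : ρ (Pi.single i 1) = Pi.single i (1 : ℝ) := by
      funext j
      by_cases hj : j = i
      · subst hj; simp [ρ]
      · simp [ρ, hj]
    have h4 := Submodule.span_le_restrictScalars ℚ ℝ
      (ρ '' Set.range (fun y : Y => b.equivFun ⟨(y : W), hmem y y.2⟩)) h2
    rw [Submodule.restrictScalars_mem, h3] at h4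
    exact Submodule.span_mono hsub h4
  have hspan : Submodule.span ℝ (A : Set (Fin r → ℝ)) = ⊤ := by
    rw [eq_top_iff, ← (Pi.basisFun ℝ (Fin r)).span_eq]
    apply Submodule.span_le.mpr
    rintro _ ⟨i, rfl⟩
    rw [Pi.basisFun_apply]
    exact hsingle i
  -- Step 4: hence the affine span of `A` is everything (`0 ∈ A`)
  have h0A : (0 : Fin r → ℝ) ∈ (A : Set (Fin r → ℝ)) := by
    rw [Finset.mem_coe, hA, Finset.mem_image]
    refine ⟨0, h0, ?_⟩
    rw [he 0 U.zero_mem]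
    have : (⟨0, U.zero_mem⟩ : U) = 0 := rfl
    rw [this, map_zero, map_zero]
  have hvs : vectorSpan ℝ (A : Set (Fin r → ℝ)) = ⊤ := by
    apply top_unique
    rw [← hspan]
    apply Submodule.span_le.mpr
    intro x hx
    have := vsub_mem_vectorSpan ℝ hx h0A
    simpa using this
  have hfin : 3 ≤ Module.finrank ℝ (vectorSpan ℝ (A : Set (Fin r → ℝ))) := by
    rw [hvs, finrank_top, Module.finrank_fin_fun]
    rw [hr] at h3
    exact h3
  have key := hFreiman r 3 A (by norm_num) hfin
  norm_num at key
  omega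


/-! ### Integer plane coordinates when the graph has rank `2` -/

/-- Clearing a common denominator: if `x.den ∣ D` then `(D / x.den) * x.num` is the integer
`D x`. -/
theorem soloFS_clear_den (D : ℕ) (x : ℚ) (hd : x.den ∣ D) :
    ((((D / x.den : ℕ) : ℤ) * x.num : ℤ) : ℚ) = (D : ℚ) * x := by
  have h1 : ((D / x.den : ℕ) : ℚ) * (x.den : ℚ) = (D : ℚ) := by
    rw [← Nat.cast_mul, Nat.div_mul_cancel hd]
  have h2 : x * (x.den : ℚ) = (x.num : ℚ) := Rat.mul_den_eq_num x
  rw [Int.cast_mul, Int.cast_natCast, ← h2, ← h1]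
  ring

/-- **Plane coordinates.**  If the `ℚ`-span of the points `v a`, `a ∈ S`, has dimension `2`,
then these points have integer coordinates `z a ∈ ℤ × ℤ` with respect to a suitable pair of
vectors `w₀, w₁`, and every additive coincidence `v a + v b = v c + v d` transfers to the
coordinates. -/
theorem soloFS_plane_coords {ι W : Type*} [AddCommGroup W] [Module ℚ W] [DecidableEq W]
    (S : Finset ι) (v : ι → W)
    (h2 : Module.finrank ℚ (Submodule.span ℚ ((S.image v : Finset W) : Set W)) = 2) :
    ∃ (w₀ w₁ : W) (z : ι → ℤ × ℤ),
      (∀ a ∈ S, v a = ((z a).1 : ℚ) • w₀ + ((z a).2 : ℚ) • w₁) ∧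
      (∀ a ∈ S, ∀ b ∈ S, ∀ c ∈ S, ∀ d ∈ S,
        v a + v b = v c + v d → z a + z b = z c + z d) := by
  classical
  obtain ⟨U, hU⟩ : ∃ U : Submodule ℚ W,
      U = Submodule.span ℚ ((S.image v : Finset W) : Set W) := ⟨_, rfl⟩
  rw [← hU] at h2
  haveI : Module.Finite ℚ U := by
    rw [hU]; exact FiniteDimensional.span_of_finite ℚ (S.image v).finite_toSet
  let B : Module.Basis (Fin 2) ℚ U := Module.finBasisOfFinrankEq ℚ U h2
  have hmem : ∀ a ∈ S, v a ∈ U := by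
    intro a ha
    rw [hU]
    apply Submodule.subset_span
    rw [Finset.coe_image]
    exact Set.mem_image_of_mem v (Finset.mem_coe.mpr ha)
  -- lifts of the points to `U` (junk value `0` outside `S`)
  let vv : ι → U := fun a => if ha : a ∈ S then ⟨v a, hmem a ha⟩ else 0
  have hvv : ∀ a ∈ S, ((vv a : U) : W) = v a := fun a ha => by
    simp only [vv, dif_pos ha]
  -- rational coordinates
  obtain ⟨x, hx⟩ : ∃ x : ι → ℚ, ∀ a, x a = B.equivFun (vv a) 0 := ⟨_, fun _ => rfl⟩
  obtain ⟨y, hy⟩ : ∃ y : ι → ℚ, ∀ a, y a = B.equivFun (vv a) 1 := ⟨_, fun _ => rfl⟩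
  have hdec : ∀ a ∈ S, v a = x a • ((B 0 : U) : W) + y a • ((B 1 : U) : W) := by
    intro a ha
    have h := B.sum_equivFun (vv a)
    rw [Fin.sum_univ_two, ← hx a, ← hy a] at h
    have h' := congrArg Subtype.val h
    simp only [Submodule.coe_add, Submodule.coe_smul] at h'
    rw [hvv a ha] at h'
    exact h'.symm
  have hadd : ∀ a ∈ S, ∀ b ∈ S, ∀ c ∈ S, ∀ d ∈ S, v a + v b = v c + v d →
      x a + x b = x c + x d ∧ y a + y b = y c + y d := by
    intro a ha b hb c hc d hd h
    have hU4 : vv a + vv b = vv c + vv d := by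
      apply Subtype.ext
      simp only [Submodule.coe_add, hvv a ha, hvv b hb, hvv c hc, hvv d hd, h]
    have h4 := congrArg B.equivFun hU4
    rw [map_add, map_add] at h4
    refine ⟨?_, ?_⟩
    · have := congrFun h4 0
      simp only [Pi.add_apply] at this
      rw [hx a, hx b, hx c, hx d]
      exact this
    · have := congrFun h4 1
      simp only [Pi.add_apply] at this
      rw [hy a, hy b, hy c, hy d]
      exact this
  -- a common denominator
  obtain ⟨D, hDpos, hdx, hdy⟩ : ∃ D : ℕ, 0 < D ∧ (∀ a ∈ S, (x a).den ∣ D) ∧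
      (∀ a ∈ S, (y a).den ∣ D) := by
    refine ⟨∏ a ∈ S, ((x a).den * (y a).den), ?_, ?_, ?_⟩
    · exact Finset.prod_pos (fun a _ => Nat.mul_pos (x a).den_pos (y a).den_pos)
    · intro a ha
      exact (dvd_mul_right _ _).trans
        (Finset.dvd_prod_of_mem (fun a => (x a).den * (y a).den) ha)
    · intro a ha
      exact (dvd_mul_left _ _).trans
        (Finset.dvd_prod_of_mem (fun a => (x a).den * (y a).den) ha)
  have hD : (D : ℚ) ≠ 0 := by exact_mod_cast hDpos.ne'
  refine ⟨(D : ℚ)⁻¹ • ((B 0 : U) : W), (D : ℚ)⁻¹ • ((B 1 : U) : W),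
    fun a => ((((D / (x a).den : ℕ) : ℤ) * (x a).num), (((D / (y a).den : ℕ) : ℤ) * (y a).num)),
    ?_, ?_⟩
  · intro a ha
    dsimp only
    rw [soloFS_clear_den D (x a) (hdx a ha), soloFS_clear_den D (y a) (hdy a ha), smul_smul,
      smul_smul]
    have e1 : (D : ℚ) * x a * (D : ℚ)⁻¹ = x a := by
      rw [mul_comm (D : ℚ) (x a)]; exact mul_inv_cancel_right₀ hD (x a)
    have e2 : (D : ℚ) * y a * (D : ℚ)⁻¹ = y a := by
      rw [mul_comm (D : ℚ) (y a)]; exact mul_inv_cancel_right₀ hD (y a)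
    rw [e1, e2]
    exact hdec a ha
  · intro a ha b hb c hc d hd h
    obtain ⟨hX, hY⟩ := hadd a ha b hb c hc d hd h
    have kx : ((((D / (x a).den : ℕ) : ℤ) * (x a).num + ((D / (x b).den : ℕ) : ℤ) * (x b).num : ℤ)
        : ℚ) = ((((D / (x c).den : ℕ) : ℤ) * (x c).num + ((D / (x d).den : ℕ) : ℤ) * (x d).num
        : ℤ) : ℚ) := by
      rw [Int.cast_add, Int.cast_add, soloFS_clear_den D (x a) (hdx a ha),
        soloFS_clear_den D (x b) (hdx b hb), soloFS_clear_den D (x c) (hdx c hc),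
        soloFS_clear_den D (x d) (hdx d hd), ← mul_add, ← mul_add, hX]
    have ky : ((((D / (y a).den : ℕ) : ℤ) * (y a).num + ((D / (y b).den : ℕ) : ℤ) * (y b).num : ℤ)
        : ℚ) = ((((D / (y c).den : ℕ) : ℤ) * (y c).num + ((D / (y d).den : ℕ) : ℤ) * (y d).num
        : ℤ) : ℚ) := by
      rw [Int.cast_add, Int.cast_add, soloFS_clear_den D (y a) (hdy a ha),
        soloFS_clear_den D (y b) (hdy b hb), soloFS_clear_den D (y c) (hdy c hc),
        soloFS_clear_den D (y d) (hdy d hd), ← mul_add, ← mul_add, hY]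
    exact Prod.ext (Int.cast_injective kx) (Int.cast_injective ky)

end Summit.Schanuel.Schanuel.Theorems
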